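import Summits.MatrixMultiplication.OmegaCensus.STPP122RankThreeCertEngine

/-!
# (1,2,2)³ in (ℤ/3)³ — the RANK-3 ROOM CERTIFICATE, covering decisions A (`decide +kernel`, chunks `b = 0 … 13`)

Cell `pub-omega` (unit `pub-omega-stpp-1-g34`), topic `Summits/MatrixMultiplication/OmegaCensus`.
HONEST FRAMING (verbatim): lottery ticket; floor = certified bounds/negative ranges. Kernel decisions of `Rank3Cert.coverB g3 b` (engine and
meaning: `STPP122RankThreeCertEngine.lean`); nothing here is a bound on `ω`.
-/

namespace Summit.MatrixMultiplication.OmegaCensus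

namespace Rank3Cert

open STPP211Neg

set_option maxRecDepth 20000
set_option maxHeartbeats 1000000

/-- Covering, chunk `b = 0` (kernel). -/
theorem cover_0 : coverB g3 0 = true := by
  decide +kernel

/-- Covering, chunk `b = 1` (kernel). -/
theorem cover_1 : coverB g3 1 = true := by
  decide +kernel

/-- Covering, chunk `b = 2` (kernel). -/
theorem cover_2 : coverB g3 2 = true := by
  decide +kernel

/-- Covering, chunk `b = 3` (kernel). -/
theorem cover_3 : coverB g3 3 = true := by
  decide +kernel

/-- Covering, chunk `b = 4` (kernel). -/
theorem cover_4 : coverB g3 4 = true := by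
  decide +kernel

/-- Covering, chunk `b = 5` (kernel). -/
theorem cover_5 : coverB g3 5 = true := by
  decide +kernel

/-- Covering, chunk `b = 6` (kernel). -/
theorem cover_6 : coverB g3 6 = true := by
  decide +kernel

/-- Covering, chunk `b = 7` (kernel). -/
theorem cover_7 : coverB g3 7 = true := by
  decide +kernel

/-- Covering, chunk `b = 8` (kernel). -/
theorem cover_8 : coverB g3 8 = true := by
  decide +kernel

/-- Covering, chunk `b = 9` (kernel). -/
theorem cover_9 : coverB g3 9 = true := by
  decide +kernel

/-- Covering, chunk `b = 10` (kernel). -/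
theorem cover_10 : coverB g3 10 = true := by
  decide +kernel

/-- Covering, chunk `b = 11` (kernel). -/
theorem cover_11 : coverB g3 11 = true := by
  decide +kernel

/-- Covering, chunk `b = 12` (kernel). -/
theorem cover_12 : coverB g3 12 = true := by
  decide +kernel

/-- Covering, chunk `b = 13` (kernel). -/
theorem cover_13 : coverB g3 13 = true := by
  decide +kernel

end Rank3Cert

end Summit.MatrixMultiplication.OmegaCensus
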